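import Summits.AtomisticToContinuum.HydrodynamicLimit.Theorems.UGibbsSRBRigidityTemperedCollisionsDiscIntegral
import HarnessLib

/-!
# `UGibbsSRBRigidity.TemperedCollisions` (stmt-AtomisticToContinuum-9391), step 1b:
# the WEIGHTED swept tube — the inverse normal relative speed integrates to `2π ε² h`

Helper file (`--supports stmt-AtomisticToContinuum-9391`) for the support item `TemperedCollisions` of the route
`UGibbsSRBRigidity` (N-uniform bound on `E[Σ_collisions ε_N/|⟨x_i − x_j, v_i − v_j⟩|]`, the tempered-singularity
input).  The companion count bound (`JParityClosureCollisionTightnessSweptTube`, stmt-13085) showed that the set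
`S(u)` of relative positions `r` (`‖r‖ ≥ ε`) from which free relative motion with velocity `u` reaches the contact
sphere within time `h` — the swept tube, in the coordinates `λ = ⟪r, û⟫`, `p = r − λû`, `a = √(ε² − ‖p‖²)`:
`‖p‖ ≤ ε`, `λ ∈ [−a − h‖u‖, −a] ∪ {a}` — has volume `≤ 4 ε² h ‖u‖`.  The MARK of the item at the contact so
reached is `ε/|⟨εν, u⟩| = 1/|⟨ν, u⟩|`, and since the normal component of the contact direction is `⟨ν, û⟩ = ±a/ε`
(the transverse offset `p` is conserved along the flight), the mark is the explicit weight `ε / (‖u‖ a)` on the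
tube.  This file proves the **weighted tube bound**

* `lintegral_tubeProdWeight_le`, `lintegral_tubeCoordWeight_le`, `lintegral_tube_weight_le` —
  `∫ 𝟙_{S(u)}(r) · ε/(‖u‖ a(r)) dr ≤ 2π ε² h` for EVERY `u` (fibres of length `h‖u‖`, then the disc integral of
  step 1a; the factor `‖u‖` cancels exactly — the collision-cylinder identity `dr = ε² |⟨ν,u⟩| dν dt` read against the
  mark `1/|⟨ν,u⟩|` —, which is why the tempered collision sum needs no velocity moment at all).  For `u = 0` the
  weight is the junk value `0`.

The rotation of `û` to a coordinate axis and the product decomposition are those of `volume_tube_le`.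

References: C. Cercignani, R. Illner, M. Pulvirenti, *The Mathematical Theory of Dilute Gases* (1994), App. 4.A
(collision cylinder); N. Chernov, J. Stat. Phys. 88 (1997) 1–29, §9 (the `|⟨n,v⟩|`-weighted boundary measure).
-/

noncomputable section

open MeasureTheory Set Filter Topology
open scoped ENNReal InnerProductSpace

namespace Summit.AtomisticToContinuum.HydrodynamicLimit.Theorems

open Literature.Analysis.FluidPDE Literature.MathematicalPhysics.KineticTheory

/-! ### The weighted tube in product coordinates -/

/-- A real inequality behind the fibre computation: `ε/(U a) · (h U) ≤ (ε h) · (1/a)` (equality unless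
`U a = 0`, when the left side is the junk value `0`). [folklore] -/
theorem div_mul_mul_le {ε h U a : ℝ} (hε : 0 ≤ ε) (hh : 0 ≤ h) (ha : 0 ≤ a) :
    ε / (U * a) * (h * U) ≤ ε * h * (1 / a) := by
  by_cases hU : U = 0
  · subst hU
    simp only [zero_mul, div_zero, mul_zero]
    positivity
  by_cases ha0 : a = 0
  · subst ha0
    simp
  · have : ε / (U * a) * (h * U) = ε * h * (1 / a) := by field_simp
    rw [this]

/-- **The weighted tube in product coordinates.** In coordinates `(λ, y) ∈ ℝ × ℝ²` the tube is
`y₀² + y₁² ≤ ε²`, `λ ∈ [−a − hU, −a] ∪ {a}`, `a = √(ε² − y₀² − y₁²)`; integrating the weight `ε/(U a)`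
(constant along each fibre of length `h U`) gives at most `ε h ∫_{disc} dy / a(y) ≤ 2π ε² h`. [folklore] -/
theorem lintegral_tubeProdWeight_le {ε h U : ℝ} (hε : 0 < ε) (hh : 0 ≤ h) (hU : 0 ≤ U) :
    ∫⁻ p : ℝ × (Fin 2 → ℝ), {p : ℝ × (Fin 2 → ℝ) | p.2 0 ^ 2 + p.2 1 ^ 2 ≤ ε ^ 2 ∧
          (p.1 ∈ Icc (-Real.sqrt (ε ^ 2 - (p.2 0 ^ 2 + p.2 1 ^ 2)) - h * U)
              (-Real.sqrt (ε ^ 2 - (p.2 0 ^ 2 + p.2 1 ^ 2))) ∨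
            p.1 = Real.sqrt (ε ^ 2 - (p.2 0 ^ 2 + p.2 1 ^ 2)))}.indicator
        (fun p => ENNReal.ofReal (ε / (U * Real.sqrt (ε ^ 2 - (p.2 0 ^ 2 + p.2 1 ^ 2))))) p ≤
      ENNReal.ofReal (2 * Real.pi * ε ^ 2 * h) := by
  set T : Set (ℝ × (Fin 2 → ℝ)) := {p | p.2 0 ^ 2 + p.2 1 ^ 2 ≤ ε ^ 2 ∧
    (p.1 ∈ Icc (-Real.sqrt (ε ^ 2 - (p.2 0 ^ 2 + p.2 1 ^ 2)) - h * U)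
        (-Real.sqrt (ε ^ 2 - (p.2 0 ^ 2 + p.2 1 ^ 2))) ∨
      p.1 = Real.sqrt (ε ^ 2 - (p.2 0 ^ 2 + p.2 1 ^ 2)))} with hT
  have hTm : MeasurableSet T := by
    have hq : Measurable fun p : ℝ × (Fin 2 → ℝ) => p.2 0 ^ 2 + p.2 1 ^ 2 := by fun_prop
    have ha : Measurable fun p : ℝ × (Fin 2 → ℝ) =>
        Real.sqrt (ε ^ 2 - (p.2 0 ^ 2 + p.2 1 ^ 2)) := by fun_prop
    refine (measurableSet_le hq measurable_const).inter ?_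
    exact MeasurableSet.union ((measurableSet_le (by fun_prop) measurable_fst).inter
      (measurableSet_le measurable_fst (by fun_prop))) (measurableSet_eq_fun measurable_fst ha)
  set D : Set (Fin 2 → ℝ) := {y | y 0 ^ 2 + y 1 ^ 2 ≤ ε ^ 2} with hD
  have hDm : MeasurableSet D := measurableSet_le (by fun_prop) measurable_const
  set w : (Fin 2 → ℝ) → ℝ≥0∞ := fun y =>
    ENNReal.ofReal (ε / (U * Real.sqrt (ε ^ 2 - (y 0 ^ 2 + y 1 ^ 2)))) with hw
  have hwm : Measurable w :=
    (by fun_prop : Measurable fun y : Fin 2 → ℝ =>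
      ε / (U * Real.sqrt (ε ^ 2 - (y 0 ^ 2 + y 1 ^ 2)))).ennreal_ofReal
  have hint : (T.indicator fun p : ℝ × (Fin 2 → ℝ) =>
      ENNReal.ofReal (ε / (U * Real.sqrt (ε ^ 2 - (p.2 0 ^ 2 + p.2 1 ^ 2))))) =
      T.indicator fun p => w p.2 := rfl
  have hFm : Measurable (T.indicator fun p : ℝ × (Fin 2 → ℝ) => w p.2) :=
    (hwm.comp measurable_snd).indicator hTm
  have hvol : (volume : Measure (ℝ × (Fin 2 → ℝ))) = volume.prod volume := rfl
  rw [hint, hvol, lintegral_prod_symm _ hFm.aemeasurable]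
  -- fibres
  have hfib : ∀ y, ∫⁻ x, T.indicator (fun p : ℝ × (Fin 2 → ℝ) => w p.2) (x, y) ≤
      D.indicator (fun y => w y * ENNReal.ofReal (h * U)) y := by
    intro y
    have hsec : (fun x => T.indicator (fun p : ℝ × (Fin 2 → ℝ) => w p.2) (x, y)) =
        ((fun x : ℝ => (x, y)) ⁻¹' T).indicator (fun _ => w y) := by
      funext x
      simp only [Set.indicator, mem_preimage]
    have hSm : MeasurableSet ((fun x : ℝ => (x, y)) ⁻¹' T) :=
      hTm.preimage (measurable_id.prodMk measurable_const)
    rw [hsec, lintegral_indicator_const hSm]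
    by_cases hy : y ∈ D
    · rw [indicator_of_mem hy]
      gcongr
      set a := Real.sqrt (ε ^ 2 - (y 0 ^ 2 + y 1 ^ 2)) with ha
      have hsub : (fun x : ℝ => (x, y)) ⁻¹' T ⊆ Icc (-a - h * U) (-a) ∪ {a} := by
        intro x hx
        simp only [mem_preimage, hT, mem_setOf_eq] at hx
        rcases hx.2 with h1 | h1
        · exact Or.inl h1
        · exact Or.inr h1
      calc volume ((fun x : ℝ => (x, y)) ⁻¹' T)
          ≤ volume (Icc (-a - h * U) (-a) ∪ {a}) := measure_mono hsub
        _ ≤ volume (Icc (-a - h * U) (-a)) + volume ({a} : Set ℝ) := measure_union_le _ _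
        _ = ENNReal.ofReal (h * U) := by
            rw [Real.volume_Icc, Real.volume_singleton, add_zero]
            congr 1
            ring
    · rw [indicator_of_notMem hy]
      have hempty : (fun x : ℝ => (x, y)) ⁻¹' T = ∅ := by
        ext x
        simp only [mem_preimage, hT, mem_setOf_eq, mem_empty_iff_false, iff_false, not_and]
        intro hx
        exact absurd hx hy
      rw [hempty, measure_empty, mul_zero]
  -- pointwise: `w y · (hU) ≤ (ε h) · (1/a)`
  have hpt : ∀ y, D.indicator (fun y => w y * ENNReal.ofReal (h * U)) y ≤
      ENNReal.ofReal (ε * h) *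
        D.indicator (fun y => ENNReal.ofReal (1 / Real.sqrt (ε ^ 2 - (y 0 ^ 2 + y 1 ^ 2)))) y := by
    intro y
    by_cases hy : y ∈ D
    · rw [indicator_of_mem hy, indicator_of_mem hy, hw]
      rw [← ENNReal.ofReal_mul (by positivity), ← ENNReal.ofReal_mul (by positivity)]
      exact ENNReal.ofReal_le_ofReal (div_mul_mul_le hε.le hh (Real.sqrt_nonneg _))
    · rw [indicator_of_notMem hy, indicator_of_notMem hy, mul_zero]
  calc ∫⁻ y, ∫⁻ x, T.indicator (fun p : ℝ × (Fin 2 → ℝ) => w p.2) (x, y)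
      ≤ ∫⁻ y, D.indicator (fun y => w y * ENNReal.ofReal (h * U)) y := lintegral_mono hfib
    _ ≤ ∫⁻ y, ENNReal.ofReal (ε * h) *
        D.indicator (fun y => ENNReal.ofReal (1 / Real.sqrt (ε ^ 2 - (y 0 ^ 2 + y 1 ^ 2)))) y :=
        lintegral_mono hpt
    _ = ENNReal.ofReal (ε * h) *
        ∫⁻ y, D.indicator (fun y => ENNReal.ofReal (1 / Real.sqrt (ε ^ 2 - (y 0 ^ 2 + y 1 ^ 2)))) y := by
        rw [lintegral_const_mul]
        exact Measurable.indicator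
          ((by fun_prop : Measurable fun y : Fin 2 → ℝ =>
            1 / Real.sqrt (ε ^ 2 - (y 0 ^ 2 + y 1 ^ 2))).ennreal_ofReal) hDm
    _ ≤ ENNReal.ofReal (ε * h) * ENNReal.ofReal (2 * ε * Real.pi) := by
        gcongr
        exact lintegral_disc_inv_sqrt_le hε
    _ = ENNReal.ofReal (2 * Real.pi * ε ^ 2 * h) := by
        rw [← ENNReal.ofReal_mul (by positivity)]
        congr 1
        ring


/-- **The weighted tube in coordinates `x : Fin 3 → ℝ`** (axis = coordinate `2`): split off the coordinate `2`
(`volume_preserving_piFinSuccAbove`) and use the product bound. [folklore] -/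
theorem lintegral_tubeCoordWeight_le {ε h U : ℝ} (hε : 0 < ε) (hh : 0 ≤ h) (hU : 0 ≤ U) :
    ∫⁻ x : Fin 3 → ℝ, {x : Fin 3 → ℝ | x 0 ^ 2 + x 1 ^ 2 ≤ ε ^ 2 ∧
      (x 2 ∈ Icc (-Real.sqrt (ε ^ 2 - (x 0 ^ 2 + x 1 ^ 2)) - h * U)
          (-Real.sqrt (ε ^ 2 - (x 0 ^ 2 + x 1 ^ 2))) ∨
        x 2 = Real.sqrt (ε ^ 2 - (x 0 ^ 2 + x 1 ^ 2)))}.indicator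
        (fun x => ENNReal.ofReal (ε / (U * Real.sqrt (ε ^ 2 - (x 0 ^ 2 + x 1 ^ 2))))) x ≤
      ENNReal.ofReal (2 * Real.pi * ε ^ 2 * h) := by
  set T : Set (ℝ × (Fin 2 → ℝ)) := {p | p.2 0 ^ 2 + p.2 1 ^ 2 ≤ ε ^ 2 ∧
    (p.1 ∈ Icc (-Real.sqrt (ε ^ 2 - (p.2 0 ^ 2 + p.2 1 ^ 2)) - h * U)
        (-Real.sqrt (ε ^ 2 - (p.2 0 ^ 2 + p.2 1 ^ 2))) ∨
      p.1 = Real.sqrt (ε ^ 2 - (p.2 0 ^ 2 + p.2 1 ^ 2)))} with hT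
  have hTm : MeasurableSet T := by
    have hq : Measurable fun p : ℝ × (Fin 2 → ℝ) => p.2 0 ^ 2 + p.2 1 ^ 2 := by fun_prop
    have ha : Measurable fun p : ℝ × (Fin 2 → ℝ) =>
        Real.sqrt (ε ^ 2 - (p.2 0 ^ 2 + p.2 1 ^ 2)) := by fun_prop
    refine (measurableSet_le hq measurable_const).inter ?_
    exact MeasurableSet.union ((measurableSet_le (by fun_prop) measurable_fst).inter
      (measurableSet_le measurable_fst (by fun_prop))) (measurableSet_eq_fun measurable_fst ha)
  set Fp : ℝ × (Fin 2 → ℝ) → ℝ≥0∞ := T.indicator fun p =>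
    ENNReal.ofReal (ε / (U * Real.sqrt (ε ^ 2 - (p.2 0 ^ 2 + p.2 1 ^ 2)))) with hFp
  have hFpm : Measurable Fp :=
    (by fun_prop : Measurable fun p : ℝ × (Fin 2 → ℝ) =>
      ε / (U * Real.sqrt (ε ^ 2 - (p.2 0 ^ 2 + p.2 1 ^ 2)))).ennreal_ofReal.indicator hTm
  have hcomp : (fun x : Fin 3 → ℝ => {x : Fin 3 → ℝ | x 0 ^ 2 + x 1 ^ 2 ≤ ε ^ 2 ∧
      (x 2 ∈ Icc (-Real.sqrt (ε ^ 2 - (x 0 ^ 2 + x 1 ^ 2)) - h * U)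
          (-Real.sqrt (ε ^ 2 - (x 0 ^ 2 + x 1 ^ 2))) ∨
        x 2 = Real.sqrt (ε ^ 2 - (x 0 ^ 2 + x 1 ^ 2)))}.indicator
        (fun x => ENNReal.ofReal (ε / (U * Real.sqrt (ε ^ 2 - (x 0 ^ 2 + x 1 ^ 2))))) x) =
      fun x => Fp (MeasurableEquiv.piFinSuccAbove (fun _ : Fin 3 => ℝ) 2 x) := by
    funext x
    rfl
  rw [hcomp, (volume_preserving_piFinSuccAbove (fun _ : Fin 3 => ℝ) 2).lintegral_comp hFpm]
  exact lintegral_tubeProdWeight_le hε hh hU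

/-! ### Rotating `u` to a coordinate axis: the weighted swept tube -/

/-- **The weighted swept tube has integral at most `2π ε² h`.** For the swept tube
`S(u) = {‖p‖ ≤ ε, λ ∈ [−a − h‖u‖, −a] ∪ {a}}` (`λ = ⟪r, û⟫`, `p = r − λ û`, `a = √(ε² − ‖p‖²)`) of the companion
count bound (`volume_tube_le`, `vol S(u) ≤ 4ε²h‖u‖`), the WEIGHT `ε/(‖u‖ a)` — the inverse normal component
`1/|⟪ν, u⟫|` of the relative velocity at the contact reached along the fibre — integrates to at most `2π ε² h`,
with NO factor `‖u‖` (the collision cylinder `ε²|⟪ν,u⟫| dν dt` exactly cancels the mark). For `u = 0` the weight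
is the junk value `0`. [folklore] -/
theorem lintegral_tube_weight_le {ε h : ℝ} (hε : 0 < ε) (hh : 0 ≤ h) (u : V3) :
    ∫⁻ r : V3, {r : V3 | ‖r - ⟪r, ‖u‖⁻¹ • u⟫_ℝ • (‖u‖⁻¹ • u)‖ ≤ ε ∧
      (⟪r, ‖u‖⁻¹ • u⟫_ℝ ∈
          Icc (-Real.sqrt (ε ^ 2 - ‖r - ⟪r, ‖u‖⁻¹ • u⟫_ℝ • (‖u‖⁻¹ • u)‖ ^ 2) - h * ‖u‖)
            (-Real.sqrt (ε ^ 2 - ‖r - ⟪r, ‖u‖⁻¹ • u⟫_ℝ • (‖u‖⁻¹ • u)‖ ^ 2)) ∨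
        ⟪r, ‖u‖⁻¹ • u⟫_ℝ = Real.sqrt (ε ^ 2 - ‖r - ⟪r, ‖u‖⁻¹ • u⟫_ℝ • (‖u‖⁻¹ • u)‖ ^ 2))}.indicator
        (fun r => ENNReal.ofReal
          (ε / (‖u‖ * Real.sqrt (ε ^ 2 - ‖r - ⟪r, ‖u‖⁻¹ • u⟫_ℝ • (‖u‖⁻¹ • u)‖ ^ 2)))) r ≤
      ENNReal.ofReal (2 * Real.pi * ε ^ 2 * h) := by
  by_cases hu : u = 0
  · subst hu
    refine le_of_eq_of_le (lintegral_congr (g := fun _ => 0) fun r => ?_) (by simp)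
    simp
  -- `u ≠ 0`: rotate `û` to `e₂`
  set e : V3 := ‖u‖⁻¹ • u with he
  have he1 : ‖e‖ = 1 := norm_inv_norm_smul hu
  set e₂ : V3 := EuclideanSpace.single (2 : Fin 3) (1 : ℝ) with he₂
  have he₂1 : ‖e₂‖ = 1 := by
    rw [he₂, show (EuclideanSpace.single (2 : Fin 3) (1 : ℝ) : V3) =
      PiLp.single 2 (2 : Fin 3) (1 : ℝ) from rfl, PiLp.norm_single, norm_one]
  have he₂0 : e₂ 0 = 0 := by simp [he₂]
  have he₂1' : e₂ 1 = 0 := by simp [he₂]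
  have he₂2 : e₂ 2 = 1 := by simp [he₂]
  set R : V3 ≃ₗᵢ[ℝ] V3 := Submodule.reflection (ℝ ∙ (e - e₂))ᗮ with hR
  have hRe : R e = e₂ := Submodule.reflection_sub (by rw [he1, he₂1])
  have hax : ∀ r : V3, R r 2 = ⟪r, e⟫_ℝ := by
    intro r
    have h : ⟪R r, e₂⟫_ℝ = ⟪r, e⟫_ℝ := by
      rw [← hRe, LinearIsometryEquiv.inner_map_map]
    rw [← h, he₂, EuclideanSpace.inner_single_right]
    simp
  have hperp : ∀ r : V3, ‖r - ⟪r, e⟫_ℝ • e‖ ^ 2 = R r 0 ^ 2 + R r 1 ^ 2 := by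
    intro r
    have h1 : ‖r - ⟪r, e⟫_ℝ • e‖ = ‖R r - ⟪r, e⟫_ℝ • e₂‖ := by
      rw [← R.norm_map (r - ⟪r, e⟫_ℝ • e), map_sub, LinearIsometryEquiv.map_smul, hRe]
    rw [h1, EuclideanSpace.norm_eq, Real.sq_sqrt (Finset.sum_nonneg fun i _ => by positivity),
      Fin.sum_univ_three]
    simp only [PiLp.sub_apply, PiLp.smul_apply, he₂0, he₂1', he₂2, smul_eq_mul, mul_zero, mul_one,
      sub_zero, Real.norm_eq_abs, sq_abs, hax, sub_self]
    ring
  set T : Set (Fin 3 → ℝ) := {x | x 0 ^ 2 + x 1 ^ 2 ≤ ε ^ 2 ∧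
    (x 2 ∈ Icc (-Real.sqrt (ε ^ 2 - (x 0 ^ 2 + x 1 ^ 2)) - h * ‖u‖)
        (-Real.sqrt (ε ^ 2 - (x 0 ^ 2 + x 1 ^ 2))) ∨
      x 2 = Real.sqrt (ε ^ 2 - (x 0 ^ 2 + x 1 ^ 2)))} with hT
  have hTm : MeasurableSet T := measurableSet_tubeCoordSet ε h ‖u‖
  set Fc : (Fin 3 → ℝ) → ℝ≥0∞ := T.indicator fun x =>
    ENNReal.ofReal (ε / (‖u‖ * Real.sqrt (ε ^ 2 - (x 0 ^ 2 + x 1 ^ 2)))) with hFc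
  have hFcm : Measurable Fc :=
    (by fun_prop : Measurable fun x : Fin 3 → ℝ =>
      ε / (‖u‖ * Real.sqrt (ε ^ 2 - (x 0 ^ 2 + x 1 ^ 2)))).ennreal_ofReal.indicator hTm
  have hgm : Measurable fun s : V3 => Fc (WithLp.ofLp s) := hFcm.comp (WithLp.measurable_ofLp 2 _)
  -- pointwise domination of the integrand by the coordinate integrand after the rotation
  have hpt : ∀ r : V3, {r : V3 | ‖r - ⟪r, ‖u‖⁻¹ • u⟫_ℝ • (‖u‖⁻¹ • u)‖ ≤ ε ∧
      (⟪r, ‖u‖⁻¹ • u⟫_ℝ ∈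
          Icc (-Real.sqrt (ε ^ 2 - ‖r - ⟪r, ‖u‖⁻¹ • u⟫_ℝ • (‖u‖⁻¹ • u)‖ ^ 2) - h * ‖u‖)
            (-Real.sqrt (ε ^ 2 - ‖r - ⟪r, ‖u‖⁻¹ • u⟫_ℝ • (‖u‖⁻¹ • u)‖ ^ 2)) ∨
        ⟪r, ‖u‖⁻¹ • u⟫_ℝ = Real.sqrt (ε ^ 2 - ‖r - ⟪r, ‖u‖⁻¹ • u⟫_ℝ • (‖u‖⁻¹ • u)‖ ^ 2))}.indicator
        (fun r => ENNReal.ofReal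
          (ε / (‖u‖ * Real.sqrt (ε ^ 2 - ‖r - ⟪r, ‖u‖⁻¹ • u⟫_ℝ • (‖u‖⁻¹ • u)‖ ^ 2)))) r ≤
      Fc (WithLp.ofLp (R r)) := by
    intro r
    by_cases hr : r ∈ {r : V3 | ‖r - ⟪r, ‖u‖⁻¹ • u⟫_ℝ • (‖u‖⁻¹ • u)‖ ≤ ε ∧
      (⟪r, ‖u‖⁻¹ • u⟫_ℝ ∈
          Icc (-Real.sqrt (ε ^ 2 - ‖r - ⟪r, ‖u‖⁻¹ • u⟫_ℝ • (‖u‖⁻¹ • u)‖ ^ 2) - h * ‖u‖)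
            (-Real.sqrt (ε ^ 2 - ‖r - ⟪r, ‖u‖⁻¹ • u⟫_ℝ • (‖u‖⁻¹ • u)‖ ^ 2)) ∨
        ⟪r, ‖u‖⁻¹ • u⟫_ℝ = Real.sqrt (ε ^ 2 - ‖r - ⟪r, ‖u‖⁻¹ • u⟫_ℝ • (‖u‖⁻¹ • u)‖ ^ 2))}
    · rw [indicator_of_mem hr]
      obtain ⟨hp, hmem⟩ := hr
      change ‖r - ⟪r, e⟫_ℝ • e‖ ≤ ε at hp
      change ⟪r, e⟫_ℝ ∈ Icc (-Real.sqrt (ε ^ 2 - ‖r - ⟪r, e⟫_ℝ • e‖ ^ 2) - h * ‖u‖)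
          (-Real.sqrt (ε ^ 2 - ‖r - ⟪r, e⟫_ℝ • e‖ ^ 2)) ∨
        ⟪r, e⟫_ℝ = Real.sqrt (ε ^ 2 - ‖r - ⟪r, e⟫_ℝ • e‖ ^ 2) at hmem
      have hsq := hperp r
      have hRmem : WithLp.ofLp (R r) ∈ T := by
        simp only [hT, mem_setOf_eq]
        refine ⟨?_, ?_⟩
        · change R r 0 ^ 2 + R r 1 ^ 2 ≤ ε ^ 2
          rw [← hsq]
          exact pow_le_pow_left₀ (norm_nonneg _) hp 2
        · change R r 2 ∈ Icc (-Real.sqrt (ε ^ 2 - (R r 0 ^ 2 + R r 1 ^ 2)) - h * ‖u‖)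
              (-Real.sqrt (ε ^ 2 - (R r 0 ^ 2 + R r 1 ^ 2))) ∨
            R r 2 = Real.sqrt (ε ^ 2 - (R r 0 ^ 2 + R r 1 ^ 2))
          rw [← hsq, hax r]
          exact hmem
      rw [hFc, indicator_of_mem hRmem]
      change ENNReal.ofReal (ε / (‖u‖ * Real.sqrt (ε ^ 2 - ‖r - ⟪r, e⟫_ℝ • e‖ ^ 2))) ≤
        ENNReal.ofReal (ε / (‖u‖ * Real.sqrt (ε ^ 2 - (R r 0 ^ 2 + R r 1 ^ 2))))
      rw [hsq]
    · rw [indicator_of_notMem hr]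
      exact bot_le
  calc _ ≤ ∫⁻ r, Fc (WithLp.ofLp (R r)) := lintegral_mono hpt
    _ = ∫⁻ s, Fc (WithLp.ofLp s) := R.measurePreserving.lintegral_comp hgm
    _ = ∫⁻ x, Fc x := (PiLp.volume_preserving_ofLp (Fin 3)).lintegral_comp hFcm
    _ ≤ ENNReal.ofReal (2 * Real.pi * ε ^ 2 * h) := lintegral_tubeCoordWeight_le hε hh (norm_nonneg u)



end Summit.AtomisticToContinuum.HydrodynamicLimit.Theorems

end
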